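import Summits.FinalStateConjecture.FinalStateConjecture.Theorems.StarvedNecksNecksCertifyStubSeamSurgeryMain
import Summits.FinalStateConjecture.FinalStateConjecture.Theorems.StarvedNecksNecksCertifyStubChartSurgery
import Summits.FinalStateConjecture.FinalStateConjecture.Theorems.StarvedNecksNecksCertifyStubConeSeparation
import Summits.FinalStateConjecture.FinalStateConjecture.Theorems.StarvedNecksNecksCertifyKirchhoffHuygens
import Summits.FinalStateConjecture.FinalStateConjecture.Theorems.StarvedNecksNecksCertifyStubSeamClockRadii
import Summits.FinalStateConjecture.FinalStateConjecture.Theorems.StarvedNecksNecksCertifyStubSeamFlatRestrict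

/-!
# Route StarvedNecks — crux `NecksCertify`: the kernel-checked REDUCTION to the physics stub

Line `two-cap-focusing-ledger` (lead prover-line-stmt-FinalStateConjecture-13549-0, 2026-08-16).  This file
assembles the landed rungs of the line — the unconditional Kirchhoff formula and Huygens neck lemma
(`…KirchhoffHuygens.lean`), cone separation (CS), chart bookkeeping (N1b′), re-clocked radii (SCR), flat
restriction (SFR) and the seam (N2) — into one reduction theorem:

* `necksCertify_repaired_of_neckLedgerAnalysis` — **the crux under the route's repair C′ follows from the
  physics statement alone**: if every honest `C⁴` input with pairwise distinct asymptotic four-velocities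
  carries a `NeckCertificate` (statement `NeckLedgerAnalysis` of the line skeleton
  `Cruxes/NecksCertify/Lines/two_cap_focusing_ledger.lean`, granted M2 and R1), then every such input can be
  re-seamed into an honest-core SEAMED `C²` decomposition of the same exterior (the body of
  `Theses.StarvedNecks.NecksCertify` with the distinct-velocity conjunct — repair C′, rattack EVIDENCE.md §5,
  Disproof §D — added as an antecedent).  As filed (without C′) the crux is false modulo
  `EqualVelocityBinaryWitness` (`Theorems/NecksCertify/Negative/…`, p73407); this theorem is what survives.

Anchor (registered helper sub-goal): `stub_neckLedgerAnalysis_orthochronous` (projection of `Hc`(1)).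
All bundles are inlined as `let`s (verbatim bodies of the skeleton's `def`s).  No definitions, no named
facts, no `sorry`.  References: DHRT arXiv:2104.08222 §1; O'Neill 1983, Ch. 14.
-/

noncomputable section

open scoped Manifold ContDiff Topology ENNReal
open Filter Set MeasureTheory Topology Literature.Geometry.Lorentzian

namespace Summit.FinalStateConjecture.FinalStateConjecture.Theorems.NecksCertifyTwoCap.Reduction

set_option linter.dupNamespace false

/-- Registered anchor sub-goal of this file (`stub_neckLedgerAnalysis_orthochronous`): the first clause of
the crux's `Hc` bundle makes every motion orthochronous, `(Λᵢe₀)⁰ > 0` — the form in which the cone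
separation lemma consumes it. [folklore] -/
theorem stub_neckLedgerAnalysis_orthochronous :
    ∀ (𝓢 : Spacetime.{0} 4) (O : Set 𝓢.carrier) (k : ℕ) (d : FinalStateDecomposition 𝓢 O k) (R₀ : ℝ),
      (∀ i, Kerr.IsSubextremal (d.mass i) (d.spin i) ∧ 100 * d.mass i ≤ R₀ ∧
        0 < ((d.motion i).1 : E4 ≃L[ℝ] E4) (E4.basisVector 0) 0) →
      ∀ i, 0 < ((d.motion i).1 : E4 ≃L[ℝ] E4) (E4.basisVector 0) 0 :=
  fun _ _ _ _ _ h i ↦ (h i).2.2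

set_option maxHeartbeats 800000 in
/-- **`NecksCertify` under repair C′ reduces to the physics stub `NeckLedgerAnalysis`.**  Hypothesis =
the registered stub `stub_neckLedgerAnalysis` of the line skeleton (M2 → R1 → for every admissible datum,
MGHD, honest `C⁴` decomposition with pairwise distinct `Λᵢe₀`, a `NeckCertificate`), with its bundles
inlined; conclusion = the body of `Theses.StarvedNecks.NecksCertify` with the distinct-velocity conjunct
(C′) as an extra antecedent.  Proof: M2 and R1 are the unconditional exports above; cone separation from
`Hc`(1) + distinct velocities (landed CS); chart bookkeeping (landed N1b′) turns certificate + cones into the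
audited `NeckAtlas`; the seam (landed N2, fed by the landed SCR and SFR) packages it. -/
theorem necksCertify_repaired_of_neckLedgerAnalysis :
    let HonestCore := fun (𝓢 : Spacetime.{0} 4) (O : Set 𝓢.carrier) (k : ℕ)
        (d : FinalStateDecomposition 𝓢 O k) (R₀ : ℝ) ↦
      let B := d.background; let t := fun i ↦ (B i).time; let r := fun i ↦ (B i).radius; let Ψ := d.chart;
      (∀ i, Kerr.IsSubextremal (d.mass i) (d.spin i) ∧ 100 * d.mass i ≤ R₀ ∧ 0 < ((d.motion i).1 : E4 ≃L[ℝ] E4) (E4.basisVector 0) 0) ∧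
        (∀ i (ϱ τ₂ : ℝ), R₀ ≤ ϱ → d.τ₀ < τ₂ → Ψ i '' {x | d.τ₀ < t i x.1 ∧ t i x.1 < τ₂ ∧ r i x.1 < ϱ} ⊆ 𝓢.metric.causalPast 𝓢.timeOrientation (Ψ i '' (B i).truncTimeSlab ϱ τ₂)) ∧
        (∀ i (τ' : ℝ) (ϱ : ℝ → ℝ), Continuous ϱ → d.τ₀ < τ' → let A := Ψ i '' {x | τ' ≤ t i x.1 ∧ r i x.1 ≤ ϱ (t i x.1)}; closure A ∩ O ⊆ A) ∧
        (∀ y : d.flatDomain, d.τ₀ < y.1 0 → 𝓢.timeOrientation.IsFutureDirected (mfderiv 𝓘(ℝ, E4) (𝓡 4) d.flatChart y (E4.basisVector 0)))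
    let HonestFar := fun (𝓢 : Spacetime.{0} 4) (O : Set 𝓢.carrier) (k : ℕ)
        (d : FinalStateDecomposition 𝓢 O k) (R₀ : ℝ) ↦
      let B := d.background; let t := fun i ↦ (B i).time; let r := fun i ↦ (B i).radius; let Φ := d.flatChart;
      (∀ τ₂ : ℝ, d.τ₀ < τ₂ → Φ '' {y | d.τ₀ < y.1 0 ∧ y.1 0 < τ₂} ⊆ 𝓢.metric.causalPast 𝓢.timeOrientation (Φ '' (Minkowski.backgroundOn d.flatDomain).timeSlab τ₂)) ∧
        (∀ τ' : ℝ, d.τ₀ < τ' → closure (Φ '' {y | τ' ≤ y.1 0 ∧ ∀ i, d.excision i (y.1 0) + 1 ≤ r i y.1}) ⊆ Φ '' {y | τ' ≤ y.1 0}) ∧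
        (∀ i, ∃ T : ℝ, supCkENorm (Subtype.val '' {x : (B i).domain | T ≤ t i x.1 ∧ R₀ ≤ r i x.1 ∧ ∀ j, j ≠ i → r i x.1 ≤ r j x.1}) 0 (𝓢.deviationExtend (B i) (d.chart i)) ≤ ENNReal.ofReal (1 / (10 * ‖(((d.motion i).1 : E4 ≃L[ℝ] E4) : E4 →L[ℝ] E4)‖ ^ 2)))
    let Seamed := fun (𝓢 : Spacetime.{0} 4) (O : Set 𝓢.carrier) (d : FinalStateDecomposition 𝓢 O 2)
        (R : Fin d.N → ℝ → ℝ) (R₀ : ℝ) ↦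
      let B := d.background; let t := fun i ↦ (B i).time; let r := fun i ↦ (B i).radius; let Λ := fun i ↦ ((d.motion i).1 : E4 ≃L[ℝ] E4); let Φ := d.flatChart; let Ψ := d.chart; let ρ := d.excision;
      (∀ i, Monotone (R i) ∧ Continuous (R i) ∧ ∀ s, R₀ + 4 ≤ R i s ∧ R₀ ≤ ρ i s) ∧
        (∀ i, Tendsto (fun τ ↦ 𝓢.truncDeviationCk (B i) (Ψ i) 2 (R i τ) τ) atTop (𝓝 0)) ∧
        supCkENorm (Subtype.val '' {y : d.flatDomain | d.τ₀ ≤ y.1 0}) 0 (𝓢.deviationExtend (Minkowski.backgroundOn d.flatDomain) Φ) ≤ 10⁻¹ ∧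
        (∀ i, supCkENorm (Subtype.val '' {x : (B i).domain | (d.τ₀ ≤ t i x.1 ∨ d.τ₀ ≤ x.1 0) ∧ R₀ ≤ r i x.1 ∧ r i x.1 ≤ R i (t i x.1)}) 0 (𝓢.deviationExtend (B i) (Ψ i)) ≤ ENNReal.ofReal (1 / (10 * ‖(Λ i : E4 →L[ℝ] E4)‖ ^ 2))) ∧
        (∀ i (x : (B i).domain), (d.τ₀ ≤ t i x.1 ∨ d.τ₀ ≤ x.1 0) → R₀ ≤ r i x.1 → r i x.1 ≤ R i (t i x.1) → 𝓢.timeOrientation.IsFutureDirected (mfderiv 𝓘(ℝ, E4) (𝓡 4) (Ψ i) x ((Λ i) (E4.basisVector 0)))) ∧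
        (∀ i (y : E4) (hy : y ∈ (B i).domain), d.τ₀ ≤ y 0 → (∀ j, ρ j (y 0) < r j y) → r i y ≤ R i (t i y) + 1 → ∃ hy' : y ∈ d.flatDomain, Ψ i ⟨y, hy⟩ = Φ ⟨y, hy'⟩) ∧
        (∀ y : d.flatDomain, d.τ₀ ≤ y.1 0 → ∀ j, ρ j (y.1 0) < r j y.1) ∧
        (∀ j (y : E4), d.τ₀ ≤ y 0 → r j y ≤ ρ j (y 0) → r j y + 2 ≤ R j (t j y)) ∧
        (∀ j (y : E4), d.τ₀ ≤ t j y → r j y ≤ R j (t j y) + 2 → t j y ≤ y 0) ∧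
        (∀ j, Ψ j '' {x | d.τ₀ < t j x.1 ∧ R j (t j x.1) + 1 < r j x.1} ⊆ d.radiationZone) ∧
        (∀ τ' : ℝ, d.τ₀ < τ' → closure (Φ '' {y | τ' ≤ y.1 0}) ⊆ Φ '' {y | τ' ≤ y.1 0} ∪ ⋃ j, Ψ j '' {x | τ' ≤ x.1 0 ∧ r j x.1 = ρ j (x.1 0)}) ∧
        (∀ j j' (y : E4), j ≠ j' → (d.τ₀ ≤ y 0 ∨ d.τ₀ ≤ t j y) → r j y ≤ R j (t j y) + 1 → R j' (t j' y) + 1 < r j' y)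
    let NeckCertificate := fun (𝓢 : Spacetime.{0} 4) (O : Set 𝓢.carrier) (d : FinalStateDecomposition 𝓢 O 4)
        (R₀ : ℝ) ↦
      let B := d.background; let t := fun i ↦ (B i).time; let r := fun i ↦ (B i).radius
      let Λ := fun i ↦ ((d.motion i).1 : E4 ≃L[ℝ] E4); let Φ := d.flatChart; let Ψ := d.chart
      let ρ := d.excision
      ∃ (R₁ τ₁ : ℝ) (ρa Rc : Fin d.N → ℝ → ℝ) (Ψa : ∀ i, (B i).domain → 𝓢.carrier),
        R₀ ≤ R₁ ∧ d.τ₀ ≤ τ₁ ∧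
        -- K1: analysis walls (flat-time indexed)
        (∀ i, Monotone (ρa i) ∧ Continuous (ρa i) ∧ Tendsto (fun s ↦ ρa i s / s) atTop (𝓝 0) ∧
          Tendsto (ρa i) atTop atTop ∧ ∀ s, R₁ + 1 ≤ ρa i s ∧ (τ₁ ≤ s → ρ i s + 1 ≤ ρa i s)) ∧
        -- K2: certified radii (hole-time indexed), exhausting every radius
        (∀ i, Monotone (Rc i) ∧ Continuous (Rc i) ∧ Tendsto (fun s ↦ Rc i s / s) atTop (𝓝 0) ∧
          Tendsto (Rc i) atTop atTop ∧ ∀ s, R₁ + 4 ≤ Rc i s) ∧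
        -- K3: the certified tubes swallow the analysis region with margin 3
        (∀ j (y : E4), τ₁ ≤ y 0 → r j y ≤ 9 * ρa j (y 0) → r j y + 3 ≤ Rc j (t j y)) ∧
        -- K4: the re-gauged charts on the late tubes
        (∀ i, let U : Set (B i).domain := {x | τ₁ < t i x.1 ∧ r i x.1 < Rc i (t i x.1) + 2}
          ContMDiffOn 𝓘(ℝ, E4) (𝓡 4) ∞ (Ψa i) U ∧ IsOpenEmbedding (U.restrict (Ψa i)) ∧
            Ψa i '' U ⊆ d.charted) ∧
        -- K5: near zone untouched
        (∀ i (x : (B i).domain), r i x.1 ≤ R₁ + 1 → Ψa i x = Ψ i x) ∧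
        -- K6: ONE ATLAS on the whole analysis collar `4ρa ≤ rᵢ ≤ Rc + 2` (flat-late)
        (∀ i (y : E4) (hy : y ∈ (B i).domain), τ₁ ≤ y 0 → 4 * ρa i (y 0) ≤ r i y →
          r i y ≤ Rc i (t i y) + 2 → ∃ hy' : y ∈ d.flatDomain, Ψa i ⟨y, hy⟩ = Φ ⟨y, hy'⟩) ∧
        -- K7: C² certification out to Rc (the analytic content)
        (∀ i, Tendsto (fun τ ↦ 𝓢.truncDeviationCk (B i) (Ψa i) 2 (Rc i τ) τ) atTop (𝓝 0)) ∧
        -- K8/K9: C⁰ honesty and future-directed hole time-lines on `R₁ ≤ rᵢ ≤ Rc + 2`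
        (∀ i, supCkENorm (Subtype.val '' {x : (B i).domain | τ₁ ≤ t i x.1 ∧ R₁ ≤ r i x.1 ∧
            r i x.1 ≤ Rc i (t i x.1) + 2}) 0 (𝓢.deviationExtend (B i) (Ψa i)) ≤
          ENNReal.ofReal (1 / (10 * ‖(Λ i : E4 →L[ℝ] E4)‖ ^ 2))) ∧
        (∀ i (x : (B i).domain), τ₁ ≤ t i x.1 → R₁ ≤ r i x.1 → r i x.1 ≤ Rc i (t i x.1) + 2 →
          𝓢.timeOrientation.IsFutureDirected
            (mfderiv 𝓘(ℝ, E4) (𝓡 4) (Ψa i) x ((Λ i) (E4.basisVector 0)))) ∧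
        -- K10: images of different holes' late tubes are disjoint
        (∀ i j, i ≠ j → Disjoint (Ψa i '' {x | τ₁ < t i x.1 ∧ r i x.1 < Rc i (t i x.1) + 2})
          (Ψa j '' {x | τ₁ < t j x.1 ∧ r j x.1 < Rc j (t j x.1) + 2})) ∧
        -- K11: late tube portions (continuous profiles below Rc + 2) are relatively closed in O
        (∀ i (τ' : ℝ) (ϱ : ℝ → ℝ), Continuous ϱ → τ₁ < τ' → (∀ s, ϱ s < Rc i s + 2) →
          closure (Ψa i '' {x | τ' ≤ t i x.1 ∧ r i x.1 ≤ ϱ (t i x.1)}) ∩ O ⊆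
            Ψa i '' {x | τ' ≤ t i x.1 ∧ r i x.1 ≤ ϱ (t i x.1)}) ∧
        -- K12: causal covering by the analysis atlas, for every COMPATIBLE choice of late thresholds
        (∀ (T : ℝ) (Th : Fin d.N → ℝ), τ₁ < T → (∀ j, τ₁ < Th j) →
          (∀ j (y : E4), T < y 0 → r j y ≤ Rc j (t j y) + 2 → Th j < t j y) →
          O \ (Φ '' {y | T < y.1 0 ∧ ∀ j, 5 * ρa j (y.1 0) < r j y.1} ∪
              ⋃ j, Ψa j '' {x | Th j < t j x.1 ∧ r j x.1 < Rc j (t j x.1) + 2}) ⊆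
            𝓢.metric.causalPast 𝓢.timeOrientation
              (Φ '' {y | y.1 0 = T ∧ ∀ j, 5 * ρa j (y.1 0) < r j y.1} ∪
                ⋃ j, Ψa j '' {x | t j x.1 = Th j ∧ r j x.1 < Rc j (t j x.1) + 2}))
    let HuygensNeckLemma : Prop :=
      ∀ (φ : E4 → ℝ) (T R₀ : ℝ) (ρ : ℝ → ℝ), 0 < R₀ → ContDiff ℝ ∞ φ →
        (∀ y : E4, T ≤ y 0 → R₀ ≤ E4.spatialNorm y →
          KerrSchild.waveOperator (fun _ ↦ Kerr.etaComp) φ y = 0) →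
        Monotone ρ → (∀ s, R₀ + 2 ≤ ρ s) → Tendsto (fun s ↦ ρ s / s) atTop (𝓝 0) →
        Tendsto (fun s ↦ supCkENorm {y : E4 | y 0 = s ∧ R₀ ≤ E4.spatialNorm y ∧ E4.spatialNorm y ≤ R₀ + 1} 3 φ)
          atTop (𝓝 0) →
        Tendsto (fun s ↦ supCkENorm {y : E4 | y 0 = s ∧ ρ s ≤ E4.spatialNorm y} 2 φ) atTop (𝓝 0) →
        (∀ e : ℝ, 0 < e → ∃ S : ℝ, ∀ (t : ℝ) (x : E3), S ≤ t → R₀ + 1 ≤ ‖x‖ → ‖x‖ ≤ ρ t →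
          ∫ z in {z : E3 | 4 * ρ t ≤ ‖z - x‖ ∧ ‖z - x‖ ≤ 5 * ρ t},
              (∑ m ∈ Finset.Icc 1 3, ‖iteratedFDeriv ℝ m φ (E4.ofTimeSpace (t - ‖z - x‖) z)‖ ^ 2)
            ≤ e * ρ t) →
        Tendsto (fun s ↦ supCkENorm
          {y : E4 | y 0 = s ∧ R₀ + 1 ≤ E4.spatialNorm y ∧ E4.spatialNorm y ≤ ρ s} 2 φ) atTop (𝓝 0)
    let KirchhoffFormula : Prop :=
      ∀ (ψ : E4 → ℝ), ContDiff ℝ ∞ ψ → ∀ (t : ℝ) (x : E3) (σ : ℝ), 0 < σ →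
        ψ (E4.ofTimeSpace t x) =
          (((volume : Measure E3).toSphere univ).toReal)⁻¹ *
              ∫ (w : Metric.sphere (0 : E3) 1), ψ (E4.ofTimeSpace (t - σ) (x + σ • (w : E3)))
                ∂((volume : Measure E3).toSphere)
          + σ * ((((volume : Measure E3).toSphere univ).toReal)⁻¹ *
              ∫ (w : Metric.sphere (0 : E3) 1),
                fderiv ℝ ψ (E4.ofTimeSpace (t - σ) (x + σ • (w : E3))) (E4.ofTimeSpace 1 (w : E3))
                ∂((volume : Measure E3).toSphere))
          - ∫ s in (0 : ℝ)..σ, s * ((((volume : Measure E3).toSphere univ).toReal)⁻¹ *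
              ∫ (w : Metric.sphere (0 : E3) 1),
                KerrSchild.waveOperator (fun _ ↦ Kerr.etaComp) ψ (E4.ofTimeSpace (t - s) (x + s • (w : E3)))
                ∂((volume : Measure E3).toSphere))
    (HuygensNeckLemma → KirchhoffFormula →
      ∀ (X : Type) [TopologicalSpace X] [ChartedSpace E3 X] [IsManifold (𝓡 3) ∞ X] [ConnectedSpace X]
        (D : InitialDataSet (𝓡 3) X), D ∈ admissibleVacuumData X →
        ∀ 𝒟 : VacuumCauchyDevelopment D, 𝒟.IsMaximal →
        ∀ (O : Set 𝒟.carrier) (d : FinalStateDecomposition 𝒟.toSpacetime O 4) (R₀ : ℝ),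
          O = exteriorOf 𝒟.toCauchyDevelopment d.charted →
          HonestCore 𝒟.toSpacetime O 4 d R₀ → HonestFar 𝒟.toSpacetime O 4 d R₀ →
          (∀ i j : Fin d.N, i ≠ j →
            ((d.motion i).1 : E4 ≃L[ℝ] E4) (E4.basisVector 0) ≠ ((d.motion j).1 : E4 ≃L[ℝ] E4) (E4.basisVector 0)) →
          NeckCertificate 𝒟.toSpacetime O d R₀) →
      ∀ (X : Type) [TopologicalSpace X] [ChartedSpace E3 X] [IsManifold (𝓡 3) ∞ X] [ConnectedSpace X]
        (D : InitialDataSet (𝓡 3) X), D ∈ admissibleVacuumData X →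
        ∀ 𝒟 : VacuumCauchyDevelopment D, 𝒟.IsMaximal →
        ∀ (O : Set 𝒟.carrier) (d : FinalStateDecomposition 𝒟.toSpacetime O 4) (R₀ : ℝ),
          O = exteriorOf 𝒟.toCauchyDevelopment d.charted →
          HonestCore 𝒟.toSpacetime O 4 d R₀ → HonestFar 𝒟.toSpacetime O 4 d R₀ →
          (∀ i j : Fin d.N, i ≠ j →
            ((d.motion i).1 : E4 ≃L[ℝ] E4) (E4.basisVector 0) ≠ ((d.motion j).1 : E4 ≃L[ℝ] E4) (E4.basisVector 0)) →
          ∃ (d₂ : FinalStateDecomposition 𝒟.toSpacetime O 2) (R : Fin d₂.N → ℝ → ℝ) (R₀' : ℝ),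
            O = exteriorOf 𝒟.toCauchyDevelopment d₂.charted ∧ HonestCore 𝒟.toSpacetime O 2 d₂ R₀' ∧
              Seamed 𝒟.toSpacetime O d₂ R R₀' := by
  intro HonestCore HonestFar Seamed NeckCertificate HuygensNeckLemma KirchhoffFormula hN1a X _ _ _ _ D hD 𝒟
    h𝒟 O d R₀ hO hc hf hdv
  have hK : KirchhoffFormula := Exports.kirchhoffFormula
  have hM2 : HuygensNeckLemma := Exports.huygensNeckLemma
  have hcert := hN1a hM2 hK X D hD 𝒟 h𝒟 O d R₀ hO hc hf hdv
  obtain ⟨c, hc0, τc, hcone⟩ :=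
    Cones.stub_coneSeparation _ O 4 d (stub_neckLedgerAnalysis_orthochronous _ O 4 d R₀ hc.1) hdv
  have hatlas := Bookkeeping.stub_chartSurgery X D hD 𝒟 h𝒟 O d R₀ hO hc hf hcert ⟨c, hc0, τc, hcone⟩
  exact Seam.stub_seamSurgery NecksCertifyBargmann.ClockRadii.stub_seamClockRadii
    NecksCertifyBargmann.FlatRestrict.stub_seamFlatRestrict X D hD 𝒟 h𝒟 O d R₀ hO hc hf hatlas

end Summit.FinalStateConjecture.FinalStateConjecture.Theorems.NecksCertifyTwoCap.Reduction

end
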